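import Summits.CriticalPhenomena.SAWScalingLimit.Theorems.SAWDevelopingMapObservableToSLETypeLadderCarvedReductionSqueezeZoneGeom
import HarnessLib

/-!
# The zones and the limit carving: persistence margins, links, density (piece (T-A′₂F zone bulk)
# of stub T-A′₂F `stub_carvedReduction_squeezeGeometry_domainsCoreF`)

Crux `SAWDevelopingMap.ObservableToSLE` (stmt-CriticalPhenomena-10472), line `six-class-type-ladder`,
stub T-A′₂F `stub_carvedReduction_squeezeGeometry_domainsCoreF`.  Landing target:
`Summits/CriticalPhenomena/SAWScalingLimit/Theorems/SAWDevelopingMapObservableToSLETypeLadderCarvedReductionSqueezeZoneBulk.lean`.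

The side zone `sideZone P ρ Ksp B cell conn s` (`…SqueezeZoneGeom`) against the limit package of
the carving (persistence clauses of `squeeze_limitPackage`, connectors of `connector_limits`):
* `eventually_mem_of_mem_sideZone` — PERSISTENCE: eventually every vertex pinned into the
  `σ`-zone is removed; hence (`eventually_not_mem_closure_sideZone`) points within `σ/2` of a
  present pinned vertex are off the closure of the `σ`-zone (the margin of `outerSeq`/(R));
* `eventually_removed_near_of_mem_hexInt` — points of an open connector are persistently
  surrounded by removed vertices (so open connectors lie in the closed limit hexagons);
* `exists_links` — the LINKS of `isConnected_sideZone` hold for all small shrinks: the centre of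
  a cell lies in its connector, whose dipping point `W` is within `ρ/16` of the spine;
* `exists_near_mem_sideZone` — DENSITY for the kernel property: every point of a closed limit
  cell is a limit of points of the zones (through the open cell, the open connector, or — for a
  doubly degenerate cell — the spine core).
Registered carrier: `stub_carvedReduction_zoneBulk`.
-/

noncomputable section

open scoped Topology
open Filter Set Metric
open Literature.Probability.LatticeModels (HexVertex hexGraph hexCenter triEmbed Site)
open Literature.Probability.RandomPlanarGeometry

namespace Summit.CriticalPhenomena.SAWScalingLimit.Theorems.ObservableToSLE.TypeLadder

open Summit.CriticalPhenomena.SAWScalingLimit.Theorems.ObservableToSLER.BridgeGate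

/-! ### Persistence -/

section Persistence

variable {N : ℕ} {s : ℕ → ℝ} {x : ℕ → Site 2} {U : ℕ → Set HexVertex} {P : ℂ} {ρ : ℝ} {Ksp B : Set ℂ}
  {C Cc : Fin N → ℂ} {ϱ ϱc : Fin N → ℝ}

/-- **PERSISTENCE OF THE ZONE**: eventually every vertex pinned into the `σ`-zone is removed. -/
theorem eventually_mem_of_mem_sideZone
    (hup : ∀ᶠ j in atTop, ∀ v : HexVertex, v ∉ U j →
      dist ((s j : ℂ) * hexCenter v - (s j : ℂ) * triEmbed (x j)) P < ρ / 2 →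
        P.im < ((s j : ℂ) * hexCenter v - (s j : ℂ) * triEmbed (x j)).im)
    (hKper : ∀ ε > (0 : ℝ), ∀ᶠ j in atTop, ∀ v : HexVertex,
      infDist ((s j : ℂ) * hexCenter v - (s j : ℂ) * triEmbed (x j)) Ksp ≤ ρ / 8 - ε → v ∈ U j)
    (hBper : ∀ ε > (0 : ℝ), ∀ᶠ j in atTop, ∀ v : HexVertex,
      infDist ((s j : ℂ) * hexCenter v - (s j : ℂ) * triEmbed (x j)) B ≤ ρ / 4 - ε → v ∈ U j)
    (hcell : ∀ ε > (0 : ℝ), ∀ᶠ j in atTop, ∀ (a : Fin N) (v : HexVertex),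
      (∀ ℓ : Fin 3, |skewCoord ℓ ((s j : ℂ) * hexCenter v - (s j : ℂ) * triEmbed (x j) - C a)| ≤ ϱ a - ε) → v ∈ U j)
    (hconn : ∀ ε > (0 : ℝ), ∀ᶠ j in atTop, ∀ (a : Fin N) (v : HexVertex),
      (∀ ℓ : Fin 3, |skewCoord ℓ ((s j : ℂ) * hexCenter v - (s j : ℂ) * triEmbed (x j) - Cc a)| ≤ ϱc a - ε) → v ∈ U j)
    {σ : ℝ} (hσ : 0 < σ) :
    ∀ᶠ j in atTop, ∀ v : HexVertex,
      (s j : ℂ) * hexCenter v - (s j : ℂ) * triEmbed (x j) ∈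
          sideZone P ρ Ksp B (fun a => (C a, ϱ a)) (fun a => (Cc a, ϱc a)) σ → v ∈ U j := by
  filter_upwards [hup, hKper σ hσ, hBper σ hσ, hcell σ hσ, hconn σ hσ] with j hupj hKj hBj hcj hccj v hv
  rcases hv with ((⟨h1, h2⟩ | h) | h) | h
  · by_contra hvU
    have him : ((s j : ℂ) * hexCenter v - (s j : ℂ) * triEmbed (x j)).im < P.im - σ := h1
    have hd : dist ((s j : ℂ) * hexCenter v - (s j : ℂ) * triEmbed (x j)) P < ρ / 2 := by
      have := mem_ball.1 h2; linarith
    have := hupj v hvU hd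
    linarith
  · exact hKj v (le_of_lt h)
  · exact hBj v (le_of_lt h)
  · rw [mem_iUnion] at h
    obtain ⟨a, ha | ha⟩ := h
    · exact hcj a v fun ℓ => by have := ha ℓ; simp only at this; linarith
    · exact hccj a v fun ℓ => by have := ha ℓ; simp only at this; linarith

/-- **THE PERSISTENCE MARGIN**: eventually, points within `σ/2` of a present pinned vertex are off
the closure of the `σ`-zone. -/
theorem eventually_not_mem_closure_sideZone
    (hup : ∀ᶠ j in atTop, ∀ v : HexVertex, v ∉ U j →
      dist ((s j : ℂ) * hexCenter v - (s j : ℂ) * triEmbed (x j)) P < ρ / 2 →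
        P.im < ((s j : ℂ) * hexCenter v - (s j : ℂ) * triEmbed (x j)).im)
    (hKper : ∀ ε > (0 : ℝ), ∀ᶠ j in atTop, ∀ v : HexVertex,
      infDist ((s j : ℂ) * hexCenter v - (s j : ℂ) * triEmbed (x j)) Ksp ≤ ρ / 8 - ε → v ∈ U j)
    (hBper : ∀ ε > (0 : ℝ), ∀ᶠ j in atTop, ∀ v : HexVertex,
      infDist ((s j : ℂ) * hexCenter v - (s j : ℂ) * triEmbed (x j)) B ≤ ρ / 4 - ε → v ∈ U j)
    (hcell : ∀ ε > (0 : ℝ), ∀ᶠ j in atTop, ∀ (a : Fin N) (v : HexVertex),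
      (∀ ℓ : Fin 3, |skewCoord ℓ ((s j : ℂ) * hexCenter v - (s j : ℂ) * triEmbed (x j) - C a)| ≤ ϱ a - ε) → v ∈ U j)
    (hconn : ∀ ε > (0 : ℝ), ∀ᶠ j in atTop, ∀ (a : Fin N) (v : HexVertex),
      (∀ ℓ : Fin 3, |skewCoord ℓ ((s j : ℂ) * hexCenter v - (s j : ℂ) * triEmbed (x j) - Cc a)| ≤ ϱc a - ε) → v ∈ U j)
    {σ : ℝ} (hσ : 0 < σ) :
    ∀ᶠ j in atTop, ∀ v : HexVertex, v ∉ U j → ∀ z : ℂ,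
      dist z ((s j : ℂ) * hexCenter v - (s j : ℂ) * triEmbed (x j)) ≤ σ / 2 →
        z ∉ closure (sideZone P ρ Ksp B (fun a => (C a, ϱ a)) (fun a => (Cc a, ϱc a)) σ) := by
  filter_upwards [eventually_mem_of_mem_sideZone hup hKper hBper hcell hconn (σ := σ / 4) (by positivity)]
    with j hj v hvU z hz hzcl
  refine hvU (hj v (mem_sideZone_of_mem_closure hzcl ?_))
  rw [dist_comm]; linarith

/-- **Points of an open connector are persistently surrounded by removed vertices.** -/
theorem eventually_removed_near_of_mem_hexInt {Cc₀ : ℂ} {ϱ₀ : ℝ}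
    (hconn : ∀ ε > (0 : ℝ), ∀ᶠ j in atTop, ∀ v : HexVertex,
      (∀ ℓ : Fin 3, |skewCoord ℓ ((s j : ℂ) * hexCenter v - (s j : ℂ) * triEmbed (x j) - Cc₀)| ≤ ϱ₀ - ε) → v ∈ U j)
    {z : ℂ} (hz : z ∈ hexInt Cc₀ ϱ₀ 0) :
    ∃ η > (0 : ℝ), ∀ᶠ j in atTop, ∀ v : HexVertex,
      dist ((s j : ℂ) * hexCenter v - (s j : ℂ) * triEmbed (x j)) z < η → v ∈ U j := by
  set d : ℝ := min (ϱ₀ - |skewCoord 0 (z - Cc₀)|) (min (ϱ₀ - |skewCoord 1 (z - Cc₀)|) (ϱ₀ - |skewCoord 2 (z - Cc₀)|)) with hd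
  have hz' : ∀ ℓ : Fin 3, |skewCoord ℓ (z - Cc₀)| < ϱ₀ := fun ℓ => by have := hz ℓ; linarith
  have hd0 : 0 < d := lt_min (by linarith [hz' 0]) (lt_min (by linarith [hz' 1]) (by linarith [hz' 2]))
  have hdle : ∀ ℓ : Fin 3, d ≤ ϱ₀ - |skewCoord ℓ (z - Cc₀)| := by
    intro ℓ; fin_cases ℓ
    · exact min_le_left _ _
    · exact (min_le_right _ _).trans (min_le_left _ _)
    · exact (min_le_right _ _).trans (min_le_right _ _)
  refine ⟨d / 4, by positivity, ?_⟩
  filter_upwards [hconn (d / 2) (by positivity)] with j hj v hv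
  refine hj v fun ℓ => ?_
  have h1 := abs_skewCoord_sub_le_add ℓ ((s j : ℂ) * hexCenter v - (s j : ℂ) * triEmbed (x j)) z Cc₀
  rw [dist_comm] at hv
  linarith [hdle ℓ]

end Persistence

/-! ### Links and density from the connectors -/

section Links

variable {N : ℕ} {P : ℂ} {ρ : ℝ} {Ksp B : Set ℂ} {C Cc W : Fin N → ℂ} {ϱ ϱc : Fin N → ℝ}

/-- The norm of a vector in a closed skew hexagon of radius `ϱ` is at most `3ϱ`. -/
theorem norm_le_three_mul_of_abs_skewCoord_le {w : ℂ} {ϱ₀ : ℝ} (h : ∀ ℓ : Fin 3, |skewCoord ℓ w| ≤ ϱ₀) : ‖w‖ ≤ 3 * ϱ₀ := by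
  have := norm_le_abs_skewCoord_sum w
  linarith [h 0, h 1, h 2]

/-- The retraction `Cc + (1 - t)(z - Cc)` is within `3tϱ` of `z` (`z` in the closed hexagon, `0 ≤ t`). -/
theorem dist_retract_le {Cc₀ z : ℂ} {ϱ₀ t : ℝ} (hz : ∀ ℓ : Fin 3, |skewCoord ℓ (z - Cc₀)| ≤ ϱ₀) (ht : 0 ≤ t) :
    dist (Cc₀ + (((1 - t : ℝ)) : ℂ) * (z - Cc₀)) z ≤ 3 * t * ϱ₀ := by
  rw [dist_eq_norm]
  have : Cc₀ + (((1 - t : ℝ)) : ℂ) * (z - Cc₀) - z = -(((t : ℝ) : ℂ) * (z - Cc₀)) := by push_cast; ring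
  rw [this, norm_neg, norm_mul, Complex.norm_real, Real.norm_eq_abs, abs_of_nonneg ht]
  nlinarith [norm_le_three_mul_of_abs_skewCoord_le hz, norm_nonneg (z - Cc₀)]

/-- The retraction towards `Cc` of a point `z` of the closed connector, seen from another centre
`C'` with `|skewCoord ℓ (z - C')| = 0`-type control: `|skewCoord ℓ (Cc + (1-t)(z - Cc) - z)| = t |skewCoord ℓ (z - Cc)|`. -/
theorem abs_skewCoord_retract_sub (ℓ : Fin 3) (Cc₀ z : ℂ) (t : ℝ) :
    |skewCoord ℓ (Cc₀ + (((1 - t : ℝ)) : ℂ) * (z - Cc₀) - z)| = |t| * |skewCoord ℓ (z - Cc₀)| := by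
  have : Cc₀ + (((1 - t : ℝ)) : ℂ) * (z - Cc₀) - z = (((-t : ℝ)) : ℂ) * (z - Cc₀) := by push_cast; ring
  rw [this, skewCoord_real_mul, abs_mul, abs_neg]

/-- **THE LINKS HOLD FOR SMALL SHRINKS**; see the module docstring and `isConnected_sideZone`. -/
theorem exists_links (hρ : 0 < ρ) (hϱc : ∀ a, 0 ≤ ϱc a)
    (hCS : ∀ a (ℓ : Fin 3), |skewCoord ℓ (C a - Cc a)| ≤ ϱc a) (hW : ∀ a (ℓ : Fin 3), |skewCoord ℓ (W a - Cc a)| ≤ ϱc a)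
    (hWK : ∀ a, infDist (W a) Ksp ≤ ρ / 16) :
    ∃ s₀ > (0 : ℝ), ∀ s : ℝ, 0 < s → s ≤ s₀ →
      (∀ a, (hexInt (C a) (ϱ a) s).Nonempty →
        (hexInt (C a) (ϱ a) s ∩ (hexInt (Cc a) (ϱc a) s ∪ coreZone Ksp (ρ / 8) s)).Nonempty) ∧
      (∀ a, (hexInt (Cc a) (ϱc a) s).Nonempty → (hexInt (Cc a) (ϱc a) s ∩ coreZone Ksp (ρ / 8) s).Nonempty) := by
  classical
  -- nonempty shrunken hexagons have radius `> 2s`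
  have hrad : ∀ {C₀ : ℂ} {ϱ₀ s : ℝ}, (hexInt C₀ ϱ₀ s).Nonempty → 2 * s < ϱ₀ := fun {C₀} {ϱ₀} {s} ⟨z, hz⟩ => by
    have h1 := hz 0; have h2 := abs_nonneg (skewCoord 0 (z - C₀)); linarith
  -- the link of the connector `a` with the spine core, for `0 < ϱc a`
  have link2 : ∀ a, 0 < ϱc a → ∃ m > (0 : ℝ), ∀ s : ℝ, 0 < s → s ≤ m →
      (hexInt (Cc a) (ϱc a) s ∩ coreZone Ksp (ρ / 8) s).Nonempty := by
    intro a hc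
    set t : ℝ := min (1 / 2) (ρ / (32 * (3 * ϱc a + 1))) with ht
    have ht0 : 0 < t := lt_min (by norm_num) (by positivity)
    have ht1 : t ≤ 1 := (min_le_left _ _).trans (by norm_num)
    refine ⟨min (ρ / 64) (t * ϱc a / 4), lt_min (by positivity) (by positivity), fun s hs hsm => ?_⟩
    have hs1 : s ≤ ρ / 64 := hsm.trans (min_le_left _ _)
    have hs2 : s ≤ t * ϱc a / 4 := hsm.trans (min_le_right _ _)
    set y : ℂ := Cc a + (((1 - t : ℝ)) : ℂ) * (W a - Cc a) with hy
    refine ⟨y, retract_mem_hexInt (hW a) ht1 (by nlinarith), ?_⟩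
    show infDist y Ksp < ρ / 8 - s
    have h1 : dist y (W a) ≤ 3 * t * ϱc a := dist_retract_le (hW a) ht0.le
    have h2 : 3 * t * ϱc a ≤ ρ / 32 := by
      have h3 : t ≤ ρ / (32 * (3 * ϱc a + 1)) := min_le_right _ _
      have hD : (0 : ℝ) < 32 * (3 * ϱc a + 1) := by positivity
      calc 3 * t * ϱc a ≤ 3 * (ρ / (32 * (3 * ϱc a + 1))) * ϱc a := by nlinarith [hϱc a]
        _ = 3 * ρ * ϱc a / (32 * (3 * ϱc a + 1)) := by ring
        _ ≤ ρ / 32 := by rw [div_le_iff₀ hD]; nlinarith [hϱc a, hρ.le]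
    linarith [infDist_le_infDist_add_dist (x := y) (y := W a) (s := Ksp), hWK a]
  -- per cell: a margin for both links
  have key : ∀ a, ∃ m > (0 : ℝ), ∀ s : ℝ, 0 < s → s ≤ m →
      ((hexInt (C a) (ϱ a) s).Nonempty →
        (hexInt (C a) (ϱ a) s ∩ (hexInt (Cc a) (ϱc a) s ∪ coreZone Ksp (ρ / 8) s)).Nonempty) ∧
      ((hexInt (Cc a) (ϱc a) s).Nonempty → (hexInt (Cc a) (ϱc a) s ∩ coreZone Ksp (ρ / 8) s).Nonempty) := by
    intro a
    by_cases hc : 0 < ϱc a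
    · obtain ⟨m₂, hm₂, hlink2⟩ := link2 a hc
      by_cases hp : 0 < ϱ a
      · -- retract the centre into the connector
        set t : ℝ := min (1 / 2) (ϱ a / (4 * ϱc a + 1)) with ht
        have ht0 : 0 < t := lt_min (by norm_num) (by positivity)
        have ht1 : t ≤ 1 := (min_le_left _ _).trans (by norm_num)
        refine ⟨min m₂ (min (ϱ a / 8) (t * ϱc a / 4)), lt_min hm₂ (lt_min (by positivity) (by positivity)),
          fun s hs hsm => ⟨fun _ => ?_, fun _ => hlink2 s hs (hsm.trans (min_le_left _ _))⟩⟩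
        have hs1 : s ≤ ϱ a / 8 := hsm.trans ((min_le_right _ _).trans (min_le_left _ _))
        have hs2 : s ≤ t * ϱc a / 4 := hsm.trans ((min_le_right _ _).trans (min_le_right _ _))
        set y : ℂ := Cc a + (((1 - t : ℝ)) : ℂ) * (C a - Cc a) with hy
        refine ⟨y, fun ℓ => ?_, Or.inl (retract_mem_hexInt (hCS a) ht1 (by nlinarith))⟩
        show |skewCoord ℓ (y - C a)| < ϱ a - 2 * s
        rw [hy, abs_skewCoord_retract_sub, abs_of_pos ht0]
        have h1 : t * |skewCoord ℓ (C a - Cc a)| ≤ t * ϱc a := mul_le_mul_of_nonneg_left (hCS a ℓ) ht0.le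
        have h2 : t * ϱc a ≤ ϱ a / 4 := by
          have h3 : t ≤ ϱ a / (4 * ϱc a + 1) := min_le_right _ _
          have hD : (0 : ℝ) < 4 * ϱc a + 1 := by positivity
          calc t * ϱc a ≤ ϱ a / (4 * ϱc a + 1) * ϱc a := mul_le_mul_of_nonneg_right h3 hc.le
            _ = ϱ a * ϱc a / (4 * ϱc a + 1) := by ring
            _ ≤ ϱ a / 4 := by rw [div_le_iff₀ hD]; nlinarith [hp.le, hc.le]
        linarith
      · -- empty shrunken cell
        refine ⟨m₂, hm₂, fun s hs hsm => ⟨fun hne => ?_, fun _ => hlink2 s hs hsm⟩⟩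
        exact absurd (hrad hne) (by linarith)
    · -- degenerate connector: the centre is the dipping point, inside the spine core
      have hc0 : ϱc a = 0 := le_antisymm (not_lt.1 hc) (hϱc a)
      have hCe : C a = Cc a := by
        have := eq_zero_of_skewCoord_abs_le_zero (w := C a - Cc a) (fun ℓ => by rw [← hc0]; exact hCS a ℓ)
        exact sub_eq_zero.1 this
      have hWe : W a = Cc a := by
        have := eq_zero_of_skewCoord_abs_le_zero (w := W a - Cc a) (fun ℓ => by rw [← hc0]; exact hW a ℓ)
        exact sub_eq_zero.1 this
      refine ⟨ρ / 64, by positivity, fun s hs hsm => ⟨fun hne => ?_, fun hne => ?_⟩⟩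
      · refine ⟨C a, center_mem_hexInt (hrad hne), Or.inr ?_⟩
        show infDist (C a) Ksp < ρ / 8 - s
        rw [hCe, ← hWe]
        linarith [hWK a]
      · exact absurd (hrad hne) (by linarith)
  choose m hm0 hm using key
  obtain ⟨s₀, hs₀, hle⟩ := exists_min_pos m hm0
  exact ⟨s₀, hs₀, fun s hs hss => ⟨fun a => (hm a s hs (hss.trans (hle a))).1, fun a => (hm a s hs (hss.trans (hle a))).2⟩⟩

/-- **DENSITY OF THE ZONES IN THE LIMIT CELLS**; see the module docstring. -/
theorem exists_near_mem_sideZone (hρ : 0 < ρ) (hϱ : ∀ a, 0 ≤ ϱ a) (hϱc : ∀ a, 0 ≤ ϱc a)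
    (hCS : ∀ a (ℓ : Fin 3), |skewCoord ℓ (C a - Cc a)| ≤ ϱc a) (hW : ∀ a (ℓ : Fin 3), |skewCoord ℓ (W a - Cc a)| ≤ ϱc a)
    (hWK : ∀ a, infDist (W a) Ksp ≤ ρ / 16) (a : Fin N) {p : ℂ} (hp : ∀ ℓ : Fin 3, |skewCoord ℓ (p - C a)| ≤ ϱ a)
    {r : ℝ} (hr : 0 < r) :
    ∃ s > (0 : ℝ), ∃ y ∈ sideZone P ρ Ksp B (fun a => (C a, ϱ a)) (fun a => (Cc a, ϱc a)) s, dist y p < r := by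
  -- retraction into an open hexagon of positive radius
  have retr : ∀ {C₀ : ℂ} {ϱ₀ : ℝ}, 0 < ϱ₀ → (∀ ℓ : Fin 3, |skewCoord ℓ (p - C₀)| ≤ ϱ₀) →
      ∃ s > (0 : ℝ), ∃ y ∈ hexInt C₀ ϱ₀ s, dist y p < r := by
    intro C₀ ϱ₀ h0 hp0
    set t : ℝ := min (1 / 2) (r / (3 * ϱ₀ + 1)) with ht
    have ht0 : 0 < t := lt_min (by norm_num) (by positivity)
    have ht1 : t ≤ 1 := (min_le_left _ _).trans (by norm_num)
    refine ⟨t * ϱ₀ / 4, by positivity, C₀ + (((1 - t : ℝ)) : ℂ) * (p - C₀), retract_mem_hexInt hp0 ht1 (by nlinarith), ?_⟩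
    refine (dist_retract_le hp0 ht0.le).trans_lt ?_
    have h3 : t ≤ r / (3 * ϱ₀ + 1) := min_le_right _ _
    have hD : (0 : ℝ) < 3 * ϱ₀ + 1 := by positivity
    calc 3 * t * ϱ₀ ≤ 3 * (r / (3 * ϱ₀ + 1)) * ϱ₀ := by nlinarith
      _ = 3 * r * ϱ₀ / (3 * ϱ₀ + 1) := by ring
      _ < r := by rw [div_lt_iff₀ hD]; nlinarith
  by_cases hpos : 0 < ϱ a
  · obtain ⟨s, hs, y, hy, hyp⟩ := retr hpos hp
    exact ⟨s, hs, y, Or.inr (mem_iUnion.2 ⟨a, Or.inl hy⟩), hyp⟩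
  · -- degenerate cell: `p` is the centre, which lies in the connector
    have h0 : ϱ a = 0 := le_antisymm (not_lt.1 hpos) (hϱ a)
    have hpC : p = C a := by
      have := eq_zero_of_skewCoord_abs_le_zero (w := p - C a) (fun ℓ => by rw [← h0]; exact hp ℓ)
      exact sub_eq_zero.1 this
    by_cases hc : 0 < ϱc a
    · have hpc : ∀ ℓ : Fin 3, |skewCoord ℓ (p - Cc a)| ≤ ϱc a := by rw [hpC]; exact hCS a
      obtain ⟨s, hs, y, hy, hyp⟩ := retr hc hpc
      exact ⟨s, hs, y, Or.inr (mem_iUnion.2 ⟨a, Or.inr hy⟩), hyp⟩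
    · -- doubly degenerate: the centre is the dipping point, in the spine core
      have hc0 : ϱc a = 0 := le_antisymm (not_lt.1 hc) (hϱc a)
      have hCe : C a = Cc a := by
        have := eq_zero_of_skewCoord_abs_le_zero (w := C a - Cc a) (fun ℓ => by rw [← hc0]; exact hCS a ℓ)
        exact sub_eq_zero.1 this
      have hWe : W a = Cc a := by
        have := eq_zero_of_skewCoord_abs_le_zero (w := W a - Cc a) (fun ℓ => by rw [← hc0]; exact hW a ℓ)
        exact sub_eq_zero.1 this
      refine ⟨ρ / 32, by positivity, p, Or.inl (Or.inl (Or.inr ?_)), by rw [dist_self]; exact hr⟩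
      show infDist p Ksp < ρ / 8 - ρ / 32
      rw [hpC, hCe, ← hWe]
      linarith [hWK a]

end Links

/-- **Registered carrier `stub_carvedReduction_zoneBulk`** (crux item stmt-CriticalPhenomena-10472,
stub T-A′₂F `stub_carvedReduction_squeezeGeometry_domainsCoreF`, piece THE ZONE BULK): the norm of a
vector in a closed skew hexagon of radius `ϱ` is at most `3ϱ`. -/
theorem stub_carvedReduction_zoneBulk : ∀ (w : ℂ) (ϱ : ℝ), (∀ ℓ : Fin 3, |skewCoord ℓ w| ≤ ϱ) → ‖w‖ ≤ 3 * ϱ :=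
  fun _ _ h => norm_le_three_mul_of_abs_skewCoord_le h

end Summit.CriticalPhenomena.SAWScalingLimit.Theorems.ObservableToSLE.TypeLadder

end
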